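import Literature.NumberTheory.Automorphic.ZariskiGLProducts
import HarnessLib

/-!
# Images and preimages under algebraic homomorphisms of subgroups of `GL n k` (Springer 2.2.5)
(trunk T-AUTOMORPHIC, G25 AutomorphicL)

Companion to `ZariskiGL.lean`, `ZariskiAffineSpace.lean` and `ZariskiGLProducts.lean` (namespace
`Literature.Automorphic`; concrete `k`-points vocabulary: `IsAlgebraicSubgroup ↔ IsClosed` for the local
Zariski topology `zariskiTopologyGL`, `IsZConnected`, algebraic homomorphisms
`MonoidHom.IsAlgebraicGL f` for `f : G → GL m k`, i.e. with polynomial coordinates). Proved: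

* `MonoidHom.IsAlgebraicGL.continuous` — algebraic homomorphisms are continuous;
* `MonoidHom.IsAlgebraicGL.isAlgebraicSubgroup_comap_map` — preimages of algebraic subgroups
  are algebraic (2.2.5 (i) for the kernel as the case `K = 1`, `isAlgebraicSubgroup_ker_map`);
* **`MonoidHom.IsAlgebraicGL.isAlgebraicSubgroup_range`** — **Springer 2.2.5 (ii)**: *`φ G'` is
  a closed subgroup of `G'`* — the image of an algebraic subgroup under an algebraic homomorphism
  is algebraic (over an algebraically closed field). Proof as printed: by Chevalley's theorem
  (`exists_isOpen_inter_closure_image_subset` of `ZariskiAffineSpace.lean`, read through the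
  closed embedding `glCoordFun`, Springer 1.9.5) `φ G` contains a non-empty open subset of its
  closure, so it is closed by 2.2.4 (ii) (`isClosed_of_isOpen_inter_closure`);
  `isAlgebraicSubgroup_map_of_le` for the image of an algebraic `H ≤ G`;
* **`MonoidHom.IsAlgebraicGL.isZConnected_range`** — Springer 2.2.5 (ii)–(iv): the image of a
  Zariski-connected group is Zariski-connected (closedness from (ii) and the closure form
  `IsZConnected.zariskiClosure_range` of `ZariskiGL.lean`); `isZConnected_map_of_le`;
* `diagonalHom χ`, `isAlgebraicGL_diagonalHom` — the homomorphism `g ↦ diag (χ₁ g, …, χ_N g)` built from finitely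
  many algebraic characters is algebraic (used for the map `B → B / B_u` of a flag stabiliser).

## References

* T. A. Springer, *Linear Algebraic Groups*, 2nd ed., Progress in Mathematics 9, Birkhäuser
  (1998), 1.9.5, 2.2.4 (ii), 2.2.5.
-/

open scoped MatrixGroups

namespace Literature.NumberTheory.Automorphic

open scoped Matrix

variable {k : Type*} [Field k] {n : Type*} [Fintype n] [DecidableEq n]
  {m : Type*} [Fintype m] [DecidableEq m]

attribute [local instance] zariskiTopologyGL zariskiTopologyPi

/-! ### Restriction, continuity, preimages -/

section Basic

variable {G : Subgroup (GL n k)} {f : ↥G →* GL m k}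

/-- The restriction of an algebraic homomorphism to a subgroup is algebraic (same coordinate
polynomials). [folklore] -/
theorem MonoidHom.IsAlgebraicGL.comp_inclusion (hf : MonoidHom.IsAlgebraicGL f)
    {H : Subgroup (GL n k)} (hHG : H ≤ G) :
    MonoidHom.IsAlgebraicGL (f.comp (Subgroup.inclusion hHG)) := by
  obtain ⟨P, hP⟩ := hf
  exact ⟨P, fun h c => hP (Subgroup.inclusion hHG h) c⟩

/-- In coordinates an algebraic homomorphism is the restriction of a polynomial self-map of
affine space: `glCoordFun (f g) = (c ↦ P c (glCoordFun g))`. [folklore] -/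
theorem MonoidHom.IsAlgebraicGL.exists_glCoordFun_comp (hf : MonoidHom.IsAlgebraicGL f) :
    ∃ P : GLCoord m → MvPolynomial (GLCoord n) k,
      ∀ g : ↥G, glCoordFun (f g) = fun c => MvPolynomial.eval (glCoordFun (g : GL n k)) (P c) := by
  obtain ⟨P, hP⟩ := hf
  exact ⟨P, fun g => funext fun c => hP g c⟩

/-- **Algebraic homomorphisms are continuous** for the Zariski topologies (polynomial maps of
affine space are continuous, and `GL n k` carries the induced topology, Springer 2.1.4).
[folklore] -/
theorem MonoidHom.IsAlgebraicGL.continuous (hf : MonoidHom.IsAlgebraicGL f) : Continuous f := by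
  obtain ⟨P, hP⟩ := hf.exists_glCoordFun_comp
  rw [isInducing_glCoordFun.continuous_iff]
  have e : (glCoordFun ∘ f : ↥G → GLCoord m → k) =
      (fun x c => MvPolynomial.eval x (P c)) ∘ glCoordFun ∘ (Subtype.val : ↥G → GL n k) := by
    funext g
    exact hP g
  rw [e]
  exact (continuous_of_polynomialMap P (fun _ _ => rfl)).comp
    (continuous_glCoordFun.comp continuous_subtype_val)

/-- **Preimages of algebraic subgroups under algebraic homomorphisms are algebraic** (Springer
2.2.5 (i) for kernels): for `G` algebraic, `f : G → GL m k` algebraic and `K ≤ GL m k`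
algebraic, `f⁻¹ K ≤ GL n k` is algebraic (substitute the coordinate polynomials of `f` into
the equations of `K`). [cite: SpringerLAG1998, 2.2.5 (i)] -/
theorem MonoidHom.IsAlgebraicGL.isAlgebraicSubgroup_comap_map (hf : MonoidHom.IsAlgebraicGL f)
    (hG : IsAlgebraicSubgroup G) {K : Subgroup (GL m k)} (hK : IsAlgebraicSubgroup K) :
    IsAlgebraicSubgroup ((K.comap f).map G.subtype) := by
  obtain ⟨P, hP⟩ := hf
  obtain ⟨S', hS'⟩ := hK
  obtain ⟨S, hS⟩ := hG
  have hmemL : ∀ g : GL n k, g ∈ (K.comap f).map G.subtype ↔ ∃ hg : g ∈ G, f ⟨g, hg⟩ ∈ K := by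
    intro g
    constructor
    · rintro ⟨g', hg', rfl⟩
      exact ⟨g'.2, hg'⟩
    · rintro ⟨hg, hgK⟩
      exact ⟨⟨g, hg⟩, hgK, rfl⟩
  refine ⟨S ∪ MvPolynomial.bind₁ P '' S', Set.ext fun g => ?_⟩
  rw [zeroLocusGL_union, SetLike.mem_coe, hmemL, Set.mem_inter_iff, ← hS, SetLike.mem_coe]
  have hcoord : ∀ hg : g ∈ G,
      (fun c => MvPolynomial.eval (glCoordFun g) (P c)) = glCoordFun (f ⟨g, hg⟩) :=
    fun hg => funext fun c => (hP ⟨g, hg⟩ c).symm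
  constructor
  · rintro ⟨hg, hgK⟩
    refine ⟨hg, ?_⟩
    rw [← SetLike.mem_coe, hS'] at hgK
    simp only [zeroLocusGL, Set.mem_setOf_eq, Set.forall_mem_image, eval_bind₁] at hgK ⊢
    intro p hp
    rw [hcoord hg]
    exact hgK p hp
  · rintro ⟨hg, hgZ⟩
    refine ⟨hg, ?_⟩
    rw [← SetLike.mem_coe, hS']
    simp only [zeroLocusGL, Set.mem_setOf_eq, Set.forall_mem_image, eval_bind₁] at hgZ ⊢
    intro p hp
    rw [← hcoord hg]
    exact hgZ hp

/-- In particular **kernels of algebraic homomorphisms are algebraic** (Springer 2.2.5 (i)).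
[cite: SpringerLAG1998, 2.2.5 (i)] -/
theorem MonoidHom.IsAlgebraicGL.isAlgebraicSubgroup_ker_map (hf : MonoidHom.IsAlgebraicGL f)
    (hG : IsAlgebraicSubgroup G) : IsAlgebraicSubgroup (f.ker.map G.subtype) := by
  have h := hf.isAlgebraicSubgroup_comap_map hG isAlgebraicSubgroup_bot
  rwa [MonoidHom.comap_bot] at h

end Basic

/-! ### Springer 2.2.5 (ii): images are closed -/

section Images

variable [IsAlgClosed k] {G : Subgroup (GL n k)} {f : ↥G →* GL m k}

/-- **Chevalley's theorem for an algebraic homomorphism**: the image `f G` of an algebraic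
`G ≤ GL n k` under an algebraic `f : G → GL m k` contains a non-empty open subset of its
closure (Springer 1.9.5 applied to the morphism `f`, read in the coordinates `x i j, det⁻¹` of
source and target). [cite: SpringerLAG1998, 1.9.5 with 2.2.5 (ii)] -/
theorem MonoidHom.IsAlgebraicGL.exists_isOpen_inter_closure_range
    (hf : MonoidHom.IsAlgebraicGL f) (hG : IsAlgebraicSubgroup G) :
    ∃ W : Set (GL m k), IsOpen W ∧ (W ∩ closure (f.range : Set (GL m k))).Nonempty ∧
      W ∩ closure (f.range : Set (GL m k)) ⊆ f.range := by
  obtain ⟨P, hP⟩ := hf.exists_glCoordFun_comp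
  have hcembn := isClosedEmbedding_glCoordFun (n := n) (k := k)
  have hcembm := isClosedEmbedding_glCoordFun (n := m) (k := k)
  -- `V = G` in coordinates, `φ` the polynomial map, `φ V = f G` in coordinates
  set V : Set (GLCoord n → k) := glCoordFun '' (G : Set (GL n k)) with hV
  have hVcl : IsClosed V := hcembn.isClosedMap _ hG.isClosed
  have hVne : V.Nonempty := ⟨glCoordFun 1, 1, G.one_mem, rfl⟩
  set φ : (GLCoord n → k) → (GLCoord m → k) := fun x c => MvPolynomial.eval x (P c) with hφ
  have himg : φ '' V = glCoordFun '' (f.range : Set (GL m k)) := by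
    apply Set.Subset.antisymm
    · rintro _ ⟨_, ⟨g, hg, rfl⟩, rfl⟩
      exact ⟨f ⟨g, hg⟩, ⟨⟨g, hg⟩, rfl⟩, hP ⟨g, hg⟩⟩
    · rintro _ ⟨_, ⟨g, rfl⟩, rfl⟩
      exact ⟨glCoordFun (g : GL n k), ⟨g, g.2, rfl⟩, (hP g).symm⟩
  obtain ⟨W', hW', hW'ne, hW'sub⟩ :=
    exists_isOpen_inter_closure_image_subset hVcl.isLocallyClosed hVne P (φ := φ)
      (fun _ _ => rfl)
  rw [himg, hcembm.closure_image_eq] at hW'ne hW'sub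
  refine ⟨glCoordFun ⁻¹' W', hW'.preimage continuous_glCoordFun, ?_, ?_⟩
  · obtain ⟨_, hwW, ⟨r, hr, rfl⟩⟩ := hW'ne
    exact ⟨r, hwW, hr⟩
  · rintro r ⟨hrW, hrcl⟩
    obtain ⟨r', hr', hrr'⟩ := hW'sub ⟨hrW, ⟨r, hrcl, rfl⟩⟩
    rw [← glCoordFun_injective hrr']
    exact hr'

/-- **Springer 2.2.5 (ii): the image of an algebraic group under an algebraic homomorphism is an
algebraic (closed) subgroup** (*"`φ G'` is a closed subgroup"*): for `G ≤ GL n k` algebraic over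
an algebraically closed field and `f : G → GL m k` algebraic, `f G ≤ GL m k` is algebraic. By
Chevalley (`exists_isOpen_inter_closure_range`) and 2.2.4 (ii) (`isClosed_of_isOpen_inter_closure`).
[cite: SpringerLAG1998, 2.2.5 (ii)] -/
theorem MonoidHom.IsAlgebraicGL.isAlgebraicSubgroup_range (hf : MonoidHom.IsAlgebraicGL f)
    (hG : IsAlgebraicSubgroup G) : IsAlgebraicSubgroup f.range := by
  obtain ⟨W, hW, hne, hsub⟩ := hf.exists_isOpen_inter_closure_range hG
  exact isAlgebraicSubgroup_iff_isClosed.2 (isClosed_of_isOpen_inter_closure f.range hW hne hsub)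

/-- **Springer 2.2.5 (ii) for subgroups**: the image `f H` of an algebraic subgroup `H ≤ G` under
an algebraic homomorphism `f : G → GL m k` is algebraic. [cite: SpringerLAG1998, 2.2.5 (ii)] -/
theorem MonoidHom.IsAlgebraicGL.isAlgebraicSubgroup_map_of_le (hf : MonoidHom.IsAlgebraicGL f)
    {H : Subgroup (GL n k)} (hH : IsAlgebraicSubgroup H) (hHG : H ≤ G) :
    IsAlgebraicSubgroup ((H.subgroupOf G).map f) := by
  have h := (hf.comp_inclusion hHG).isAlgebraicSubgroup_range hH
  have e : (f.comp (Subgroup.inclusion hHG)).range = (H.subgroupOf G).map f := by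
    ext y
    constructor
    · rintro ⟨h, rfl⟩
      exact ⟨Subgroup.inclusion hHG h, by simp [Subgroup.mem_subgroupOf], rfl⟩
    · rintro ⟨g, hg, rfl⟩
      exact ⟨⟨(g : GL n k), hg⟩, rfl⟩
  rwa [e] at h

/-- **Springer 2.2.5 (ii)–(iv): the image of a Zariski-connected group under an algebraic
homomorphism is Zariski-connected** (*"`φ(G°) = (φ G)°`"*; with (ii) the image is closed, and a
closed finite-index subgroup of it pulls back to one of `G`). Over an algebraically closed field.
[cite: SpringerLAG1998, 2.2.5 (ii), (iv)] -/
theorem MonoidHom.IsAlgebraicGL.isZConnected_range (hf : MonoidHom.IsAlgebraicGL f)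
    (hG : IsZConnected G) : IsZConnected f.range := by
  have hcl := IsZConnected.zariskiClosure_range hf hG le_rfl
  have e : (f.comp (Subgroup.inclusion (le_refl G))).range = f.range := by
    ext y
    constructor
    · rintro ⟨g, rfl⟩
      exact ⟨Subgroup.inclusion le_rfl g, rfl⟩
    · rintro ⟨g, rfl⟩
      refine ⟨g, ?_⟩
      change f (Subgroup.inclusion le_rfl g) = f g
      congr 1
  rw [e, (hf.isAlgebraicSubgroup_range hG.1).zariskiClosure_eq] at hcl
  exact hcl

/-- The image `f H` of a Zariski-connected subgroup `H ≤ G` under an algebraic homomorphism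
`f : G → GL m k` is Zariski-connected. [cite: SpringerLAG1998, 2.2.5 (ii), (iv)] -/
theorem MonoidHom.IsAlgebraicGL.isZConnected_map_of_le (hf : MonoidHom.IsAlgebraicGL f)
    {H : Subgroup (GL n k)} (hH : IsZConnected H) (hHG : H ≤ G) :
    IsZConnected ((H.subgroupOf G).map f) := by
  have h := (hf.comp_inclusion hHG).isZConnected_range hH
  have e : (f.comp (Subgroup.inclusion hHG)).range = (H.subgroupOf G).map f := by
    ext y
    constructor
    · rintro ⟨h, rfl⟩
      exact ⟨Subgroup.inclusion hHG h, by simp [Subgroup.mem_subgroupOf], rfl⟩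
    · rintro ⟨g, hg, rfl⟩
      exact ⟨⟨(g : GL n k), hg⟩, rfl⟩
  rwa [e] at h

end Images

/-! ### Diagonal homomorphisms built from algebraic characters -/

section Diagonal

variable {G : Subgroup (GL n k)} {N : Type*} [Fintype N] [DecidableEq N]

/-- The homomorphism `g ↦ diag (χ₁ g, …, χ_N g) : G → GL N k` defined by a family of characters
of `G`. [folklore] -/
def diagonalHom (χ : N → (↥G →* kˣ)) : ↥G →* GL N k :=
  (diagonalGL N k).comp (MonoidHom.pi χ)

/-- `diagonalHom χ g = diag (χ i g)`. [folklore] -/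
@[simp] lemma diagonalHom_apply (χ : N → (↥G →* kˣ)) (g : ↥G) :
    diagonalHom χ g = diagonalGL N k fun i => χ i g := rfl

/-- `diagonalHom χ` takes values in the diagonal torus `𝔻_N`. [folklore] -/
lemma diagonalHom_mem_diagonalSubgroup (χ : N → (↥G →* kˣ)) (g : ↥G) :
    diagonalHom χ g ∈ diagonalSubgroup N k := ⟨_, rfl⟩

/-- `diagonalHom χ g = 1` iff all `χ i g = 1`. [folklore] -/
lemma diagonalHom_eq_one_iff (χ : N → (↥G →* kˣ)) (g : ↥G) :
    diagonalHom χ g = 1 ↔ ∀ i, χ i g = 1 := by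
  rw [diagonalHom_apply]
  constructor
  · intro h i
    have hi := congrArg (fun M : GL N k => (M : Matrix N N k) i i) h
    simp only [coe_diagonalGL, Matrix.diagonal_apply_eq, Units.val_one, Matrix.one_apply_eq] at hi
    exact Units.ext hi
  · intro h
    apply Units.ext
    simp [h]

/-- **A diagonal homomorphism built from algebraic characters is algebraic**: its entries are the
polynomials of the `χ i` (or `0`), and `det⁻¹ = ∏ (χ i)⁻¹` is the product of the polynomials of
the algebraic characters `(χ i)⁻¹`. [folklore] -/
theorem isAlgebraicGL_diagonalHom {χ : N → (↥G →* kˣ)} (hχ : ∀ i, IsAlgebraicChar (χ i)) :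
    MonoidHom.IsAlgebraicGL (diagonalHom χ) := by
  classical
  have hχ' := hχ
  choose p hp using hχ'
  choose q hq using fun i => (hχ i).inv
  refine ⟨Sum.elim (fun ij => if ij.1 = ij.2 then p ij.1 else 0) (fun _ => ∏ i, q i), ?_⟩
  intro g c
  rcases c with ⟨i, j⟩ | u
  · simp only [Sum.elim_inl, glCoordFun_inl, diagonalHom_apply, coe_diagonalGL,
      Matrix.diagonal_apply]
    split_ifs with h
    · subst h
      exact hp i g
    · rw [map_zero]
  · simp only [Sum.elim_inr, glCoordFun_inr, diagonalHom_apply, coe_diagonalGL,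
      Matrix.det_diagonal, map_prod]
    rw [← Finset.prod_inv_distrib]
    refine Finset.prod_congr rfl fun i _ => ?_
    rw [← hq i g, MonoidHom.inv_apply, Units.val_inv_eq_inv_val]

end Diagonal

end Literature.NumberTheory.Automorphic
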